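import Mathlib
import HarnessLib
import Literature.MathematicalPhysics.QuantumLattice.FermiRG.Salmhofer1998VolumeImprovementProof
import Summits.HubbardSuperconductivity.HubbardSuperconductivity.Theorems.KLProgrammeFermiSurfaceTwoShellVolumeCore
import Summits.HubbardSuperconductivity.HubbardSuperconductivity.Theorems.KLProgrammeFermiSurfaceTwoLoopAngular
import Summits.HubbardSuperconductivity.HubbardSuperconductivity.Theorems.KLProgrammeFermiSurfaceSalmhofer1998

/-!
# Salmhofer 1998 Lemma 6/(6.11) for the Hubbard band, part 2b: the TWO-SHELL VOLUME BOUND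
# `vol{(𝐤₁,𝐤₂) ∈ 𝓑² : |ε𝐤₁-μ| ≤ ε₁, |ε𝐤₂-μ| ≤ ε₂, |ε(±𝐤₁±𝐤₂+q)-μ| ≤ ε} ≤ V ε₁ε₂ε(1+|log ε|)` — `TwoShellVolumeBound` DISCHARGED,
# hence `LoopBoundsHold` for the Hubbard propagator

Cell `gate-hubbard-kl`, seat p4 (C5a lead), g8; t7's CONSUMER HOOK (typer t7 g11, `Salmhofer1998VolumeImprovementProof`: Lemma 7 (6.9)
PROVED modulo the one geometric HYP predicate `TwoShellVolumeBound M V` = print's (6.11)→(6.12) with Lemma 6 inserted).  For the Hubbard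
datum `M_μ = (ε = 1, E = ε(𝐩) - μ, v̂ ≡ U, k₀, ε₀)` of fs-1's `klfs_sal98_hyp` we PROVE `∃ V, TwoShellVolumeBound M_μ V` with ONE `V` on
every compact level range `μ ∈ [a, b] ⊂ (-4, 0)`, all `U`, `k₀`, `0 < ε₀ ≤ 1` (**`kltsv_exists_twoShellVolumeBound`**), exactly along print
p.22 L174 – p.23 L21: both shells are polar tubes of radial half-width `√2ε_j/Dt_min` about the curve (part 1, `kltsv_radius_sub_le`);
moving each momentum to the curve point at its own angle displaces the third band by `≤ 8ε/Dt_min` (`|∇ε| ≤ 2` coordinatewise,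
`kltsv_abs_sqDispersion_sub_le`), so the constraint becomes the ANGULAR one at thickness `(1 + 8/Dt_min)ε`; the product of the two tube
measures pushed to the angles is dominated by `(π+δ)²(2δ₁)(2δ₂)·dθ₁dθ₂` (part 1, `kltsv_map_arg_restrict_tube_le`, `Measure.prod_mono`);
and the remaining iterated angular integral is fs-1's **`kltl_exists_angular_bound`** (FST II Theorem 1.1 for the band, `Q ε|log ε|`, umklapp
included).  Large `ε` (above a threshold fixed by the window) is absorbed by the product of the two shell areas (`kltsv_shell_volume_le`).

(The elementary inputs, the measure-theoretic core `kltsv_volume_le_angular` and the one-shell area `kltsv_shell_volume_le` are part 2a,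
`…TwoShellVolumeCore.lean`.)

* **`kltsv_exists_twoShellVolumeBound`**, `kltsv_twoShellVolumeBound_hubbard` (single level);
* **`kltsv_loopBoundsHold_hubbard`** — Salmhofer's standing hypothesis `LoopBoundsHold` of Theorems 3–7 ((6.8)+(6.9), constants `B, K₀, J₁`
  uniform in `β`) for the Hubbard propagator at every `-4 < μ < 0`, every `U`, `k₀ ≥ 2`, `0 < ε₀ ≤ 1`, every cutoff `χ₁`
  (`loopBoundsHold_modelProp_of_twoShellVolume` ∘ `klfs_sal98_hyp`): the F-091 residual is CLOSED for the model of record.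

Everything is proved; no definitions, no named facts. [cite: Salmhofer1998, Lemma 6 (p.22 L46–62), Lemma 7 proof (6.11)–(6.12) (p.22 L173 – p.23 L21)]
-/

noncomputable section

open Real Set MeasureTheory
open scoped ENNReal

-- the tree's namespace `Summit.<Summit>.<Problem>.Theorems` repeats the summit name by design (D-0017)
set_option linter.dupNamespace false

namespace Summit.HubbardSuperconductivity.HubbardSuperconductivity.Theorems

open Literature.MathematicalPhysics.QuantumLattice
open Literature.MathematicalPhysics.QuantumLattice.BandSectorCounting
open Literature.MathematicalPhysics.QuantumLattice.FermiRG
open Literature.MathematicalPhysics.QuantumLattice.FermiRG.Salmhofer1998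

/-! ### §4 The two-shell volume bound for the Hubbard datum -/

section Main

variable {a b : ℝ} (ha : -4 < a) (hab : a ≤ b) (hb : b < 0)
include ha hab hb

/-- **`TwoShellVolumeBound` for the Hubbard datum, uniformly on a compact level range.** For `-4 < a ≤ b < 0` there is `V ≥ 0` such that
for every `μ ∈ [a, b]`, every `U`, `k₀`, `0 < ε₀ ≤ 1`, the model `(1, ε - μ, U, U, k₀, ε₀)` satisfies
`TwoShellVolumeBound M V`: `vol{(𝐤₁,𝐤₂) ∈ 𝓑² : |ε𝐤₁ - μ| ≤ ε₁, |ε𝐤₂ - μ| ≤ ε₂, |ε(v₁𝐤₁ + v₂𝐤₂ + q) - μ| ≤ ε} ≤ V ε₁ε₂ε(1 + |log ε|)` for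
`0 < ε₁, ε₂ ≤ ε ≤ ε₀`, all signs and transfers. [cite: Salmhofer1998, Lemma 6 (p.22 L46–62) and Lemma 7 proof (6.11)–(6.12) (p.22 L173 – p.23 L21)] -/
theorem kltsv_exists_twoShellVolumeBound :
    ∃ V : ℝ, 0 ≤ V ∧ ∀ μ ∈ Icc a b, ∀ (U : ℝ) (k₀ : ℕ) (ε₀ : ℝ), 0 < ε₀ → ε₀ ≤ 1 →
      TwoShellVolumeBound (ModelData.mk 1 (fun p : Fin 2 → ℝ => sqDispersion p - μ) (fun _ _ => U) (fun _ => U) k₀ ε₀ :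
        ModelData 2) V := by
  have hπ := Real.pi_pos
  -- the enlarged level range and its band constants
  obtain ⟨η₀, hη₀⟩ : ∃ η₀ : ℝ, η₀ = min (a + 4) (-b) / 2 := ⟨_, rfl⟩
  have hη₀0 : 0 < η₀ := by rw [hη₀]; exact div_pos (lt_min (by linarith) (by linarith)) two_pos
  have hη₀a : η₀ ≤ (a + 4) / 2 := by rw [hη₀]; linarith [min_le_left (a + 4) (-b)]
  have hη₀b : η₀ ≤ -b / 2 := by rw [hη₀]; linarith [min_le_right (a + 4) (-b)]
  have ha' : -4 < a - η₀ := by linarith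
  have hb' : b + η₀ < 0 := by linarith
  have hab' : a - η₀ ≤ b + η₀ := by linarith
  set B : BandBounds (a - η₀) (b + η₀) := bandBounds ha' hab' hb' with hB
  have hD := B.Dtmin_pos
  -- fs-1's angular two-loop bound on `[a, b]`
  obtain ⟨Q, hQ, hang⟩ := kltl_exists_angular_bound ha hab hb
  -- constants
  set D : ℝ := B.Dtmin with hDdef
  set C' : ℝ := 1 + 8 / D with hC'
  have h8D : 0 ≤ 8 / D := by positivity
  have hC'1 : 1 ≤ C' := by rw [hC']; linarith
  have hC'0 : 0 < C' := by linarith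
  set εs : ℝ := min η₀ (1 / (2 * C')) with hεs
  have hεs0 : 0 < εs := by rw [hεs]; positivity
  have hεsη : εs ≤ η₀ := min_le_left _ _
  have hεsC : εs ≤ 1 / (2 * C') := min_le_right _ _
  set δs : ℝ := Real.sqrt 2 * η₀ / D with hδs
  have hδs0 : 0 ≤ δs := by positivity
  set cT : ℝ := (π + δs) * 2 * (Real.sqrt 2 / D) with hcT
  have hcT0 : 0 ≤ cT := by positivity
  -- tube constant: `(π + δ)(2δ) ≤ cT · η` for `δ = √2η/D`, `η ≤ η₀`
  have htube : ∀ η : ℝ, 0 ≤ η → η ≤ η₀ →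
      (π + Real.sqrt 2 * η / D) * (2 * (Real.sqrt 2 * η / D)) ≤ cT * η := by
    intro η hη0 hηle
    have hδle : Real.sqrt 2 * η / D ≤ δs := by
      rw [hδs]; exact div_le_div_of_nonneg_right (mul_le_mul_of_nonneg_left hηle (Real.sqrt_nonneg _)) hD.le
    have h1 : 0 ≤ 2 * (Real.sqrt 2 * η / D) := by positivity
    calc (π + Real.sqrt 2 * η / D) * (2 * (Real.sqrt 2 * η / D)) ≤ (π + δs) * (2 * (Real.sqrt 2 * η / D)) :=
          mul_le_mul_of_nonneg_right (by linarith) h1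
      _ = cT * η := by rw [hcT]; ring
  set Csh : ℝ := max (cT * (2 * π)) ((2 * π) ^ 2 / η₀) with hCsh
  have hCsh0 : 0 ≤ Csh := le_max_of_le_left (by positivity)
  set VA : ℝ := cT * cT * (Q * C' * (1 + Real.log C')) with hVA
  have hlC' : 0 ≤ Real.log C' := Real.log_nonneg hC'1
  have hVA0 : 0 ≤ VA := by positivity
  set VB : ℝ := Csh * Csh / εs with hVB
  have hVB0 : 0 ≤ VB := by positivity
  refine ⟨max VA VB, le_max_of_le_left hVA0, fun μ hμ U k₀ ε₀ hε₀ hε₀1 => ⟨le_max_of_le_left hVA0, ?_⟩⟩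
  intro q v₁ v₂ ε ε₁ ε₂ hε₁0 hε₁ hε₂0 hε₂ hεε₀
  have hμ₁ : -4 < μ := ha.trans_le hμ.1
  have hμ₂ : μ < 0 := hμ.2.trans_lt hb
  have hμ' : μ ∈ Icc (a - η₀) (b + η₀) := ⟨by linarith [hμ.1], by linarith [hμ.2]⟩
  have hε0 : 0 < ε := hε₁0.trans_le hε₁
  have hε1 : ε ≤ 1 := hεε₀.trans hε₀1
  have hL : 0 ≤ |Real.log ε| := abs_nonneg _
  -- the target, with `δ_{d,2} = 1`
  have hdelta : (deltaTwo 2 : ℝ) = 1 := by simp [deltaTwo]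
  rw [hdelta, one_mul]
  -- one shell: `vol ≤ Csh · ε_j`
  have hshell : ∀ η : ℝ, 0 < η → η ≤ ε →
      volume {k : Fin 2 → ℝ | k ∈ bzBox 2 1 ∧ |sqDispersion k - μ| ≤ η} ≤ ENNReal.ofReal (Csh * η) := by
    intro η hη0 hηε
    by_cases hηs : η ≤ η₀
    · refine (kltsv_shell_volume_le B hμ' hη0.le (by linarith [hμ.1]) (by linarith [hμ.2])).trans (ENNReal.ofReal_le_ofReal ?_)
      calc (π + Real.sqrt 2 * η / B.Dtmin) * (2 * (Real.sqrt 2 * η / B.Dtmin)) * (2 * π) ≤ cT * η * (2 * π) :=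
            mul_le_mul_of_nonneg_right (htube η hη0.le hηs) (by positivity)
        _ = cT * (2 * π) * η := by ring
        _ ≤ Csh * η := mul_le_mul_of_nonneg_right (le_max_left _ _) hη0.le
    · push Not at hηs
      calc volume {k : Fin 2 → ℝ | k ∈ bzBox 2 1 ∧ |sqDispersion k - μ| ≤ η} ≤ volume (bzBox 2 1) :=
            measure_mono fun k hk => hk.1
        _ = ENNReal.ofReal ((2 * π) ^ 2) := kltsv_volume_bzBox
        _ ≤ ENNReal.ofReal (Csh * η) := by
            refine ENNReal.ofReal_le_ofReal ?_
            calc (2 * π) ^ 2 = (2 * π) ^ 2 / η₀ * η₀ := by field_simp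
              _ ≤ (2 * π) ^ 2 / η₀ * η := mul_le_mul_of_nonneg_left hηs.le (by positivity)
              _ ≤ Csh * η := mul_le_mul_of_nonneg_right (le_max_right _ _) hη0.le
  -- the set
  set M : ModelData 2 := ModelData.mk 1 (fun p : Fin 2 → ℝ => sqDispersion p - μ) (fun _ _ => U) (fun _ => U) k₀ ε₀ with hM
  set s₁ : ℝ := if v₁ then (1 : ℝ) else -1 with hs₁
  set s₂ : ℝ := if v₂ then (1 : ℝ) else -1 with hs₂
  have hs₁c : s₁ = 1 ∨ s₁ = -1 := kltsv_sign_cases v₁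
  have hs₂c : s₂ = 1 ∨ s₂ = -1 := kltsv_sign_cases v₂
  have hs₁a : |s₁| = 1 := by rcases hs₁c with h | h <;> rw [h] <;> norm_num
  have hs₂a : |s₂| = 1 := by rcases hs₂c with h | h <;> rw [h] <;> norm_num
  have hSdef : twoShellSet M ε₁ ε₂ ε v₁ v₂ q = (bzBox 2 1 ×ˢ bzBox 2 1) ∩
      {y | |sqDispersion y.1 - μ| ≤ ε₁ ∧ |sqDispersion y.2 - μ| ≤ ε₂ ∧ |sqDispersion (s₁ • y.1 + s₂ • y.2 + q) - μ| ≤ ε} := by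
    rfl
  by_cases hcase : ε ≤ εs
  · /- Case A: small `ε` — tubes, displacement to the curve, the angular bound -/
    have hεη : ε ≤ η₀ := hcase.trans hεsη
    have hC'ε : C' * ε ≤ 1 / 2 := by
      calc C' * ε ≤ C' * (1 / (2 * C')) := mul_le_mul_of_nonneg_left (hcase.trans hεsC) hC'0.le
        _ = 1 / 2 := by field_simp
    have hC'ε0 : 0 < C' * ε := mul_pos hC'0 hε0
    set τ : ℝ := -(s₁ * s₂) with hτ
    have hτc : τ = 1 ∨ τ = -1 := by
      rcases hs₁c with h1 | h1 <;> rcases hs₂c with h2 | h2 <;> rw [hτ, h1, h2] <;> norm_num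
    set q₁' : ℝ := -(s₂ * q 0) with hq₁'
    set q₂' : ℝ := -(s₂ * q 1) with hq₂'
    set Ang : Set (ℝ × ℝ) := {θ | |eps2 (bandX μ θ.2 - (τ * bandX μ θ.1 + q₁')) (bandY μ θ.2 - (τ * bandY μ θ.1 + q₂')) - μ| ≤
      C' * ε} with hAng
    have hAngm : MeasurableSet Ang := by
      have hcX : Continuous (bandX μ) := by
        unfold bandX; exact (continuous_bandFermiRadius hμ₁ hμ₂).mul Real.continuous_cos
      have hcY : Continuous (bandY μ) := by
        unfold bandY; exact (continuous_bandFermiRadius hμ₁ hμ₂).mul Real.continuous_sin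
      have hc : Continuous fun θ : ℝ × ℝ =>
          |eps2 (bandX μ θ.2 - (τ * bandX μ θ.1 + q₁')) (bandY μ θ.2 - (τ * bandY μ θ.1 + q₂')) - μ| := by
        unfold eps2; fun_prop
      exact measurableSet_le hc.measurable measurable_const
    -- pointwise: members of the two-shell set satisfy the tube and angular conditions
    have hS : ∀ y ∈ twoShellSet M ε₁ ε₂ ε v₁ v₂ q,
        |Real.sqrt (y.1 0 ^ 2 + y.1 1 ^ 2) - bandFermiRadius μ (Complex.arg ((y.1 0 : ℂ) + (y.1 1 : ℂ) * Complex.I))| ≤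
            Real.sqrt 2 * ε₁ / D ∧
          |Real.sqrt (y.2 0 ^ 2 + y.2 1 ^ 2) - bandFermiRadius μ (Complex.arg ((y.2 0 : ℂ) + (y.2 1 : ℂ) * Complex.I))| ≤
            Real.sqrt 2 * ε₂ / D ∧
          (Complex.arg ((y.1 0 : ℂ) + (y.1 1 : ℂ) * Complex.I), Complex.arg ((y.2 0 : ℂ) + (y.2 1 : ℂ) * Complex.I)) ∈ Ang := by
      intro y hy
      rw [hSdef] at hy
      obtain ⟨⟨hb1, hb2⟩, he1, he2, he3⟩ := hy
      have hk1 : ∀ i, |y.1 i| ≤ π := kltsv_abs_le_pi_of_mem_bzBox hb1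
      have hk2 : ∀ i, |y.2 i| ≤ π := kltsv_abs_le_pi_of_mem_bzBox hb2
      have hlo1 : a - η₀ ≤ μ - ε₁ := by linarith [hμ.1]
      have hhi1 : μ + ε₁ ≤ b + η₀ := by linarith [hμ.2]
      have hlo2 : a - η₀ ≤ μ - ε₂ := by linarith [hμ.1]
      have hhi2 : μ + ε₂ ≤ b + η₀ := by linarith [hμ.2]
      refine ⟨kltsv_radius_sub_le B hμ' hk1 he1 hlo1 hhi1, kltsv_radius_sub_le B hμ' hk2 he2 hlo2 hhi2, ?_⟩
      -- the angles and the curve points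
      set φ₁ : ℝ := Complex.arg ((y.1 0 : ℂ) + (y.1 1 : ℂ) * Complex.I) with hφ₁
      set φ₂ : ℝ := Complex.arg ((y.2 0 : ℂ) + (y.2 1 : ℂ) * Complex.I) with hφ₂
      have hφ₁' : Complex.arg (⟨y.1 0, y.1 1⟩ : ℂ) = φ₁ := by rw [hφ₁, Complex.mk_eq_add_mul_I]
      have hφ₂' : Complex.arg (⟨y.2 0, y.2 1⟩ : ℂ) = φ₂ := by rw [hφ₂, Complex.mk_eq_add_mul_I]
      have hc1 := RelativeSectorCount.cell_of_level_of_angle B hμ' (η := ε₁) (α := 0) (θ₀ := φ₁) (m := 0) hk1 he1 hlo1 hhi1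
        (by rw [hφ₁']; simp)
      have hc2 := RelativeSectorCount.cell_of_level_of_angle B hμ' (η := ε₂) (α := 0) (θ₀ := φ₂) (m := 0) hk2 he2 hlo2 hhi2
        (by rw [hφ₂']; simp)
      rw [mul_zero, add_zero] at hc1 hc2
      set p₁ : Fin 2 → ℝ := ![bandX μ φ₁, bandY μ φ₁] with hp₁
      set p₂ : Fin 2 → ℝ := ![bandX μ φ₂, bandY μ φ₂] with hp₂
      set w : Fin 2 → ℝ := s₁ • y.1 + s₂ • y.2 + q with hw
      set w' : Fin 2 → ℝ := s₁ • p₁ + s₂ • p₂ + q with hw'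
      -- displacement of the third band
      have hdev : ∀ j : Fin 2, |w j - w' j| ≤ |y.1 j - p₁ j| + |y.2 j - p₂ j| := by
        intro j
        have h : w j - w' j = s₁ * (y.1 j - p₁ j) + s₂ * (y.2 j - p₂ j) := by
          simp only [hw, hw', Pi.add_apply, Pi.smul_apply, smul_eq_mul]; ring
        rw [h]
        calc |s₁ * (y.1 j - p₁ j) + s₂ * (y.2 j - p₂ j)| ≤ |s₁ * (y.1 j - p₁ j)| + |s₂ * (y.2 j - p₂ j)| := abs_add_le _ _
          _ = |y.1 j - p₁ j| + |y.2 j - p₂ j| := by rw [abs_mul, abs_mul, hs₁a, hs₂a, one_mul, one_mul]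
      have hd0 : |w 0 - w' 0| ≤ ε₁ / D + ε₂ / D := by
        refine (hdev 0).trans (add_le_add ?_ ?_)
        · simpa [hp₁] using hc1.1
        · simpa [hp₂] using hc2.1
      have hd1 : |w 1 - w' 1| ≤ ε₁ / D + ε₂ / D := by
        refine (hdev 1).trans (add_le_add ?_ ?_)
        · simpa [hp₁] using hc1.2
        · simpa [hp₂] using hc2.2
      have hlip := kltsv_abs_sqDispersion_sub_le w w'
      have hsum : ε₁ / D + ε₂ / D ≤ 2 * ε / D := by
        rw [← add_div]; exact div_le_div_of_nonneg_right (by linarith) hD.le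
      have hw'bound : |sqDispersion w' - μ| ≤ C' * ε := by
        have h1 : |sqDispersion w' - μ| ≤ |sqDispersion w - μ| + |sqDispersion w - sqDispersion w'| := by
          have : sqDispersion w' - μ = (sqDispersion w - μ) - (sqDispersion w - sqDispersion w') := by ring
          rw [this]; exact abs_sub _ _
        have h2 : |sqDispersion w - sqDispersion w'| ≤ 8 * ε / D := by
          refine hlip.trans ?_
          calc 2 * (|w 0 - w' 0| + |w 1 - w' 1|) ≤ 2 * (2 * ε / D + 2 * ε / D) := by
                gcongr <;> linarith
            _ = 8 * ε / D := by ring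
        calc |sqDispersion w' - μ| ≤ ε + 8 * ε / D := h1.trans (add_le_add he3 h2)
          _ = C' * ε := by rw [hC']; ring
      -- the dictionary
      have hdic := kltsv_constraint_dictionary μ s₁ hs₂c q φ₁ φ₂
      show |eps2 (bandX μ φ₂ - (τ * bandX μ φ₁ + q₁')) (bandY μ φ₂ - (τ * bandY μ φ₁ + q₂')) - μ| ≤ C' * ε
      rw [hτ, hq₁', hq₂', ← hdic]
      exact hw'bound
    -- the core estimate
    have hδ₁ : 0 ≤ Real.sqrt 2 * ε₁ / D := by positivity
    have hδ₂ : 0 ≤ Real.sqrt 2 * ε₂ / D := by positivity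
    have hcore := kltsv_volume_le_angular hμ₁ hμ₂ hδ₁ hδ₂ hAngm hS
    -- the iterated angular integral
    have hI : ∫⁻ θ₁ in Ioo (-π) π, volume {θ₂ ∈ Ioo (-π) π | (θ₁, θ₂) ∈ Ang} ≤
        ENNReal.ofReal (Q * (C' * ε) * |Real.log (C' * ε)|) := by
      have h := hang μ hμ τ hτc q₁' q₂' (-π) (C' * ε) hC'ε0 hC'ε
      have e2 : -π + 2 * π = π := by ring
      rw [e2] at h
      refine le_trans ?_ h
      refine (lintegral_mono' (Measure.restrict_mono Ioo_subset_Icc_self le_rfl) (le_refl _)).trans ?_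
      refine lintegral_mono fun θ₁ => measure_mono fun θ₂ hθ₂ => ?_
      exact ⟨Ioo_subset_Icc_self hθ₂.1, hθ₂.2⟩
    -- assembling the real numbers
    have hc1 : ENNReal.ofReal ((π + Real.sqrt 2 * ε₁ / D) * (2 * (Real.sqrt 2 * ε₁ / D))) ≤ ENNReal.ofReal (cT * ε₁) :=
      ENNReal.ofReal_le_ofReal (htube ε₁ hε₁0.le (hε₁.trans hεη))
    have hc2 : ENNReal.ofReal ((π + Real.sqrt 2 * ε₂ / D) * (2 * (Real.sqrt 2 * ε₂ / D))) ≤ ENNReal.ofReal (cT * ε₂) :=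
      ENNReal.ofReal_le_ofReal (htube ε₂ hε₂0.le (hε₂.trans hεη))
    have hlog := kltsv_abs_log_mul_le hC'1 hε0
    have hreal : cT * ε₁ * (cT * ε₂ * (Q * (C' * ε) * |Real.log (C' * ε)|)) ≤ max VA VB * ε₁ * ε₂ * (ε * (1 + |Real.log ε|)) := by
      have h1 : Q * (C' * ε) * |Real.log (C' * ε)| ≤ Q * (C' * ε) * ((1 + Real.log C') * (1 + |Real.log ε|)) :=
        mul_le_mul_of_nonneg_left hlog (by positivity)
      calc cT * ε₁ * (cT * ε₂ * (Q * (C' * ε) * |Real.log (C' * ε)|))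
          ≤ cT * ε₁ * (cT * ε₂ * (Q * (C' * ε) * ((1 + Real.log C') * (1 + |Real.log ε|)))) := by gcongr
        _ = VA * ε₁ * ε₂ * (ε * (1 + |Real.log ε|)) := by rw [hVA]; ring
        _ ≤ max VA VB * ε₁ * ε₂ * (ε * (1 + |Real.log ε|)) := by gcongr; exact le_max_left _ _
    calc volume (twoShellSet M ε₁ ε₂ ε v₁ v₂ q)
        ≤ ENNReal.ofReal ((π + Real.sqrt 2 * ε₁ / D) * (2 * (Real.sqrt 2 * ε₁ / D))) *
            (ENNReal.ofReal ((π + Real.sqrt 2 * ε₂ / D) * (2 * (Real.sqrt 2 * ε₂ / D))) *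
              ∫⁻ θ₁ in Ioo (-π) π, volume {θ₂ ∈ Ioo (-π) π | (θ₁, θ₂) ∈ Ang}) := hcore
      _ ≤ ENNReal.ofReal (cT * ε₁) * (ENNReal.ofReal (cT * ε₂) * ENNReal.ofReal (Q * (C' * ε) * |Real.log (C' * ε)|)) := by
          gcongr
      _ = ENNReal.ofReal (cT * ε₁ * (cT * ε₂ * (Q * (C' * ε) * |Real.log (C' * ε)|))) := by
          rw [← ENNReal.ofReal_mul (by positivity), ← ENNReal.ofReal_mul (by positivity)]
      _ ≤ ENNReal.ofReal (max VA VB * ε₁ * ε₂ * (ε * (1 + |Real.log ε|))) := ENNReal.ofReal_le_ofReal hreal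
  · /- Case B: `ε` above the threshold — the product of the two shell areas -/
    push Not at hcase
    have hsub : twoShellSet M ε₁ ε₂ ε v₁ v₂ q ⊆
        {k : Fin 2 → ℝ | k ∈ bzBox 2 1 ∧ |sqDispersion k - μ| ≤ ε₁} ×ˢ {k : Fin 2 → ℝ | k ∈ bzBox 2 1 ∧ |sqDispersion k - μ| ≤ ε₂} := by
      intro y hy
      rw [hSdef] at hy
      obtain ⟨⟨hb1, hb2⟩, he1, he2, -⟩ := hy
      exact ⟨⟨hb1, he1⟩, ⟨hb2, he2⟩⟩
    have hreal : Csh * ε₁ * (Csh * ε₂) ≤ max VA VB * ε₁ * ε₂ * (ε * (1 + |Real.log ε|)) := by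
      have h1 : Csh * Csh ≤ VB * εs := by rw [hVB]; field_simp; exact le_rfl
      have h2 : VB * εs ≤ VB * (ε * (1 + |Real.log ε|)) := by
        refine mul_le_mul_of_nonneg_left ?_ hVB0
        calc εs ≤ ε := hcase.le
          _ = ε * 1 := (mul_one ε).symm
          _ ≤ ε * (1 + |Real.log ε|) := mul_le_mul_of_nonneg_left (by linarith) hε0.le
      calc Csh * ε₁ * (Csh * ε₂) = Csh * Csh * (ε₁ * ε₂) := by ring
        _ ≤ VB * (ε * (1 + |Real.log ε|)) * (ε₁ * ε₂) := mul_le_mul_of_nonneg_right (h1.trans h2) (by positivity)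
        _ = VB * ε₁ * ε₂ * (ε * (1 + |Real.log ε|)) := by ring
        _ ≤ max VA VB * ε₁ * ε₂ * (ε * (1 + |Real.log ε|)) := by gcongr; exact le_max_right _ _
    calc volume (twoShellSet M ε₁ ε₂ ε v₁ v₂ q)
        ≤ volume ({k : Fin 2 → ℝ | k ∈ bzBox 2 1 ∧ |sqDispersion k - μ| ≤ ε₁} ×ˢ
            {k : Fin 2 → ℝ | k ∈ bzBox 2 1 ∧ |sqDispersion k - μ| ≤ ε₂}) := measure_mono hsub
      _ = volume {k : Fin 2 → ℝ | k ∈ bzBox 2 1 ∧ |sqDispersion k - μ| ≤ ε₁} *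
            volume {k : Fin 2 → ℝ | k ∈ bzBox 2 1 ∧ |sqDispersion k - μ| ≤ ε₂} := by
          rw [Measure.volume_eq_prod, Measure.prod_prod]
      _ ≤ ENNReal.ofReal (Csh * ε₁) * ENNReal.ofReal (Csh * ε₂) := by
          gcongr
          · exact hshell ε₁ hε₁0 hε₁
          · exact hshell ε₂ hε₂0 hε₂
      _ = ENNReal.ofReal (Csh * ε₁ * (Csh * ε₂)) := by rw [← ENNReal.ofReal_mul (by positivity)]
      _ ≤ ENNReal.ofReal (max VA VB * ε₁ * ε₂ * (ε * (1 + |Real.log ε|))) := ENNReal.ofReal_le_ofReal hreal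

omit ha hab hb in
/-- **`TwoShellVolumeBound` at a single hole-doped level** `-4 < μ < 0`. [cite: Salmhofer1998, Lemma 7 proof (6.11)–(6.12) (p.22 L173 – p.23 L21)] -/
theorem kltsv_twoShellVolumeBound_hubbard {μ : ℝ} (hμ₁ : -4 < μ) (hμ₂ : μ < 0) (U : ℝ) (k₀ : ℕ) {ε₀ : ℝ} (hε₀ : 0 < ε₀)
    (hε₀1 : ε₀ ≤ 1) :
    ∃ V : ℝ, TwoShellVolumeBound (ModelData.mk 1 (fun p : Fin 2 → ℝ => sqDispersion p - μ) (fun _ _ => U) (fun _ => U) k₀ ε₀ :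
        ModelData 2) V := by
  obtain ⟨V, -, hV⟩ := kltsv_exists_twoShellVolumeBound hμ₁ le_rfl hμ₂
  exact ⟨V, hV μ ⟨le_rfl, le_rfl⟩ U k₀ ε₀ hε₀ hε₀1⟩

omit ha hab hb in
/-- **Salmhofer's standing loop hypothesis for the Hubbard propagator.** For every `-4 < μ < 0`, every `U`, every `k₀ ≥ 2`, `0 < ε₀ ≤ 1`
and every cutoff `χ₁` there are `B, K₀, J₁ > 0` with `LoopBoundsHold 1 β ε₀ (modelProp M χ₁) (modelPropDot M χ₁) B K₀ J₁` for ALL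
`β > 0` — both clauses (6.8) and (6.9) of Lemma 7 for the many-fermion propagator of the Hubbard datum (`klfs_sal98_hyp` +
`loopBoundsHold_modelProp_of_twoShellVolume` + the two-shell volume bound above). [cite: Salmhofer1998, Lemma 7 (6.8)–(6.9) (p.22 L117–131)] -/
theorem kltsv_loopBoundsHold_hubbard {μ : ℝ} (hμ₁ : -4 < μ) (hμ₂ : μ < 0) (U : ℝ) {k₀ : ℕ} (hk : 2 ≤ k₀) {ε₀ : ℝ}
    (hε₀ : 0 < ε₀) (hε₀1 : ε₀ ≤ 1) {χ₁ : ℝ → ℝ} (hχ : Salmhofer1998.IsCutoff χ₁) :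
    ∃ B K₀ J₁ : ℝ, 0 < B ∧ 0 < K₀ ∧ 0 < J₁ ∧ ∀ β : ℝ, 0 < β →
      LoopBoundsHold (1 : ℝ) β ε₀
        (modelProp (ModelData.mk 1 (fun p : Fin 2 → ℝ => sqDispersion p - μ) (fun _ _ => U) (fun _ => U) k₀ ε₀ : ModelData 2) χ₁)
        (modelPropDot (ModelData.mk 1 (fun p : Fin 2 → ℝ => sqDispersion p - μ) (fun _ _ => U) (fun _ => U) k₀ ε₀ : ModelData 2) χ₁)
        B K₀ J₁ := by
  obtain ⟨V, hV⟩ := kltsv_twoShellVolumeBound_hubbard hμ₁ hμ₂ U k₀ hε₀ hε₀1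
  exact loopBoundsHold_modelProp_of_twoShellVolume (klfs_sal98_hyp hμ₁ hμ₂ U hk hε₀ hε₀1) hχ hV

end Main

end Summit.HubbardSuperconductivity.HubbardSuperconductivity.Theorems

end
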